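import Summits.Ventures.YMGap.Thresholds.CouplingSmoothSUN
import Summits.Ventures.YMGap.Thresholds.CouplingSmooth
import Summits.Ventures.YMGap.Thresholds.PressureDerivative
import Summits.Ventures.YMGap.Thresholds.CouplingDerivativeClosed
import Summits.Ventures.YMGap.Thresholds.PressureDerivativeSUN
import HarnessLib

/-!
# Venture YMGap — C-SMOOTH for every `SU(N)` (iii): the `SU(N)` free energy density is `C^∞` on the open and on the CLOSED
# strong-coupling window, and its strong-coupling expansion is an asymptotic series to all orders (`d = 4`, `N ≥ 2`)

HONEST FRAMING: venture file of the cell `pub-ymgap` (QuantumFields programme), seat ds-1 (gen 12).  `SU(N)` twin of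
`PressureSmooth`: strong-coupling LATTICE statements for `SU(N)` lattice Yang–Mills on `ℤ^4` with the Wilson action at tree
coupling `b`, hypothesis-free for every `N ≥ 2` on the 't Hooft window `0 ≤ b ≤ N·9/308` (Bakry–Émery modulus): the state
map and the free energy density are `C^∞` on the open and on the closed window (one-sided derivatives at the ends,
`β = 0⁺` included), and Taylor's theorem gives the strong-coupling expansion as an ASYMPTOTIC SERIES TO ALL ORDERS.  `C^∞` /
asymptotic, NOT analytic / convergent; nothing about the continuum, confinement at weak coupling, or the Clay problem.

* `continuousOn_trunc_SU`, `continuousOn_truncSum_SU`, `truncSum_integral_eq_SU`, ★ `hasDerivWithinAt_truncSum_Icc_SU`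
  (`R_n' = N R_{n+1}` WITHIN `[0, b₁]`), ★★ `contDiffOn_infty_integral_Icc_SU`, ★★ `iteratedDerivWithin_integral_eq_SU`
  (`iteratedDerivWithin n ⟨F⟩ [0,b₁] b = Nⁿ R_n(b)`; modulus hypotheses);
* ★★★ `contDiffOn_infty_freeEnergyDensity_SU_thooft` — `ContDiffOn ℝ ∞ f (Ioo 0 (N·9/308))`, every `N ≥ 2`;
* ★★★ `contDiffOn_infty_freeEnergyDensity_Icc_SU_thooft` — `ContDiffOn ℝ ∞ f (Icc 0 (N·9/308))`, every `N ≥ 2`;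
* ★★★ `freeEnergyDensity_taylor_all_orders_SU_thooft` — `∀ n ∃ C ∀ b ∈ [0, N·9/308], |f b − taylorWithinEval f n … 0 b| ≤ C b^{n+1}`.
-/

noncomputable section

open MeasureTheory ProbabilityTheory Function Finset Filter Topology Real Set
open scoped NNReal ContDiff
open Literature.MathematicalPhysics.QuantumLattice (LGConfig ZdEdge ZdPlaquette plaquetteEdges fundamentalRep
  ymGibbsMeasures plaquetteObs freeEnergyDensity)
open Literature.MathematicalPhysics.QuantumFieldTheory hiding ZdEdge
open Literature.MathematicalPhysics.QuantumFieldTheory.Balaban1983to89.StrongCouplingDobrushinWindow (OneLinkKRModulus)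
open Literature.MathematicalPhysics.QuantumFieldTheory.Balaban1983to89.StrongCouplingKernelWindow (oneLinkKRModulus_SU)
open Literature.Probability.LatticeModels (Site Site.supNorm Site.norm_eq_supNorm)
open Summit.Ventures.YMGap.RobustBall (l1 numOrient)
open Summit.Ventures.YMGap.Cumulants

namespace Summit.Ventures.YMGap.CouplingResponse

variable {N : ℕ}

/-- Local shorthand: the normalised plaquette observable `W_q = (1/N) Re tr U_q` of `SU(N)` on `ℤ⁴`, as a family. -/
local notation3 (prettyPrint := false) "𝓦" =>
  fun q : ZdPlaquette 4 => zdPlaquetteObs (d := 4) (fundamentalRep (Fin N)) (Prod.fst q) (Prod.snd q).1.1 (Prod.snd q).1.2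

/-! ### §1 The closed window for `SU(N)` under the modulus hypotheses -/

/-- **Every truncated function is continuous in the coupling on `[0, b₁]`** (`SU(N)`, modulus hypotheses). -/
theorem continuousOn_trunc_SU (hN : 1 ≤ N) {R Kc b₁ : ℝ} (hK0 : 0 ≤ Kc)
    (hmod : OneLinkKRModulus N R Kc) (hR : b₁ / N * 6 ≤ R) (h925 : 4 * (Kc * (b₁ / N)) ≤ 9 / 25)
    {μ : ℝ → Measure (LGConfig 4 (Matrix.specialUnitaryGroup (Fin N) ℂ))}
    (hμ : ∀ b ∈ Icc (0 : ℝ) b₁, μ b ∈ ymGibbsMeasures (d := 4) (fundamentalRep (Fin N)) b)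
    {F : LGConfig 4 (Matrix.specialUnitaryGroup (Fin N) ℂ) → ℝ} {Λ : Finset (ZdEdge 4)} {K : ℝ≥0}
    (hF : IsLipschitzCylinder (fundamentalRep (Fin N)) F Λ K)
    {x₀ : Site 4} {D : ℕ} (hD : ∀ e ∈ Λ, ‖e.1 - x₀‖ ≤ D) {n : ℕ} (q : Fin n → ZdPlaquette 4) :
    ContinuousOn (fun t => trunc (μ t) F 𝓦 q) (Icc (0 : ℝ) b₁) := by
  classical
  choose ΛT KT MT DT hLT hMT hDT using slots_prod_SU (N := N) hF hD q
  exact continuousOn_ac (m := fun t T => mom (μ t) (slots F 𝓦 q) T) (S := Finset.range (n + 1))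
    (fun T _ => continuousOn_integral_SU hN hK0 hmod hR h925 hμ (hLT T) (hDT T)) 0 _ subset_rfl

/-- **The order-`n` response series is continuous on `[0, b₁]`** (`SU(N)`, modulus hypotheses). -/
theorem continuousOn_truncSum_SU (hN : 1 ≤ N) {R Kc b₁ : ℝ} (hK0 : 0 ≤ Kc)
    (hmod : OneLinkKRModulus N R Kc) (hR : b₁ / N * 6 ≤ R) (h925 : 4 * (Kc * (b₁ / N)) ≤ 9 / 25)
    {μ : ℝ → Measure (LGConfig 4 (Matrix.specialUnitaryGroup (Fin N) ℂ))}
    (hμ : ∀ b ∈ Icc (0 : ℝ) b₁, μ b ∈ ymGibbsMeasures (d := 4) (fundamentalRep (Fin N)) b)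
    {F : LGConfig 4 (Matrix.specialUnitaryGroup (Fin N) ℂ) → ℝ} {Λ : Finset (ZdEdge 4)} {K : ℝ≥0}
    (hF : IsLipschitzCylinder (fundamentalRep (Fin N)) F Λ K)
    {x₀ : Site 4} {D : ℕ} (hD : ∀ e ∈ Λ, ‖e.1 - x₀‖ ≤ D) (n : ℕ) :
    ContinuousOn (fun t => ∑' q : Fin n → ZdPlaquette 4, trunc (μ t) F 𝓦 q) (Icc (0 : ℝ) b₁) := by
  classical
  obtain ⟨A, ρ, hA0, hρ0, hρ1, h⟩ := exists_truncated_tree_bound_SU hN hK0 hmod hR h925 hF hD n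
  set u : (Fin n → ZdPlaquette 4) → ℝ := fun q => A * ∏ i, ρ ^ l1 (x₀ - (q i).1) with hu
  have hu0 : ∀ q, 0 ≤ u q := fun q => mul_nonneg hA0 (Finset.prod_nonneg fun i _ => pow_nonneg hρ0 _)
  have hus : Summable u :=
    (summable_pi_of_abs_le_prod (f := u) hA0 (fun r => pow_nonneg hρ0 _) (sum_pow_l1_plaquette_le hρ0 hρ1 x₀)
      (fun q => by rw [abs_of_nonneg (hu0 q)])).1
  refine continuousOn_tsum (fun q => continuousOn_trunc_SU hN hK0 hmod hR h925 hμ hF hD q) hus fun q t ht => ?_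
  rw [Real.norm_eq_abs]
  exact h ht.1 ht.2 (hμ t ht) q

/-- **FTC on `[0, t]`**: `∫_0^t N·R_{n+1} = R_n(t) − R_n(0)` (`SU(N)`, modulus hypotheses). -/
theorem truncSum_integral_eq_SU (hN : 1 ≤ N) {R Kc b₁ : ℝ} (hK0 : 0 ≤ Kc)
    (hmod : OneLinkKRModulus N R Kc) (hR : b₁ / N * 6 ≤ R) (h925 : 4 * (Kc * (b₁ / N)) ≤ 9 / 25)
    {μ : ℝ → Measure (LGConfig 4 (Matrix.specialUnitaryGroup (Fin N) ℂ))}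
    (hμ : ∀ b ∈ Icc (0 : ℝ) b₁, μ b ∈ ymGibbsMeasures (d := 4) (fundamentalRep (Fin N)) b)
    {F : LGConfig 4 (Matrix.specialUnitaryGroup (Fin N) ℂ) → ℝ} {Λ : Finset (ZdEdge 4)} {K : ℝ≥0}
    (hF : IsLipschitzCylinder (fundamentalRep (Fin N)) F Λ K)
    {x₀ : Site 4} {D : ℕ} (hD : ∀ e ∈ Λ, ‖e.1 - x₀‖ ≤ D) (n : ℕ) {t : ℝ} (ht : t ∈ Icc (0 : ℝ) b₁) :
    ∫ s in (0 : ℝ)..t, (N : ℝ) * (∑' q : Fin (n + 1) → ZdPlaquette 4, trunc (μ s) F 𝓦 q) =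
      (∑' q : Fin n → ZdPlaquette 4, trunc (μ t) F 𝓦 q) - ∑' q : Fin n → ZdPlaquette 4, trunc (μ 0) F 𝓦 q := by
  have hμt : ∀ b ∈ Icc (0 : ℝ) t, μ b ∈ ymGibbsMeasures (d := 4) (fundamentalRep (Fin N)) b :=
    fun b hb => hμ b ⟨hb.1, hb.2.trans ht.2⟩
  have hRt : t / N * 6 ≤ R := by
    have hN0 : (0 : ℝ) < N := by exact_mod_cast (show 0 < N by omega)
    have : t / N ≤ b₁ / N := div_le_div_of_nonneg_right ht.2 hN0.le
    linarith
  have h925t : 4 * (Kc * (t / N)) ≤ 9 / 25 := by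
    have hN0 : (0 : ℝ) < N := by exact_mod_cast (show 0 < N by omega)
    have : t / N ≤ b₁ / N := div_le_div_of_nonneg_right ht.2 hN0.le
    nlinarith
  refine intervalIntegral.integral_eq_sub_of_hasDerivAt_of_le ht.1 (continuousOn_truncSum_SU hN hK0 hmod hRt h925t hμt hF hD n)
    (fun s hs => hasDerivAt_truncSum_SU hN hK0 hmod hRt h925t hμt hF hD n hs) ?_
  exact (continuousOn_const.mul ((continuousOn_truncSum_SU hN hK0 hmod hRt h925t hμt hF hD (n + 1)).mono
    (by rw [Set.uIcc_of_le ht.1]))).intervalIntegrable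

/-- ★ **`R_n' = N·R_{n+1}` WITHIN THE CLOSED WINDOW, `b = 0` INCLUDED** (`SU(N)`, modulus hypotheses). -/
theorem hasDerivWithinAt_truncSum_Icc_SU (hN : 1 ≤ N) {R Kc b₁ : ℝ} (hK0 : 0 ≤ Kc)
    (hmod : OneLinkKRModulus N R Kc) (hR : b₁ / N * 6 ≤ R) (h925 : 4 * (Kc * (b₁ / N)) ≤ 9 / 25)
    {μ : ℝ → Measure (LGConfig 4 (Matrix.specialUnitaryGroup (Fin N) ℂ))}
    (hμ : ∀ b ∈ Icc (0 : ℝ) b₁, μ b ∈ ymGibbsMeasures (d := 4) (fundamentalRep (Fin N)) b)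
    {F : LGConfig 4 (Matrix.specialUnitaryGroup (Fin N) ℂ) → ℝ} {Λ : Finset (ZdEdge 4)} {K : ℝ≥0}
    (hF : IsLipschitzCylinder (fundamentalRep (Fin N)) F Λ K)
    {x₀ : Site 4} {D : ℕ} (hD : ∀ e ∈ Λ, ‖e.1 - x₀‖ ≤ D) (n : ℕ) {b : ℝ} (hb : b ∈ Icc (0 : ℝ) b₁) :
    HasDerivWithinAt (fun t => ∑' q : Fin n → ZdPlaquette 4, trunc (μ t) F 𝓦 q)
      ((N : ℝ) * ∑' q : Fin (n + 1) → ZdPlaquette 4, trunc (μ b) F 𝓦 q) (Icc (0 : ℝ) b₁) b :=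
  hasDerivWithinAt_of_intervalIntegral_eq (g := fun s => (N : ℝ) * ∑' q : Fin (n + 1) → ZdPlaquette 4, trunc (μ s) F 𝓦 q)
    (fun _ ht => truncSum_integral_eq_SU hN hK0 hmod hR h925 hμ hF hD n ht)
    (continuousOn_const.mul (continuousOn_truncSum_SU hN hK0 hmod hR h925 hμ hF hD (n + 1))) hb

/-- ★★ **THE `SU(N)` STATE IS `C^∞` ON THE CLOSED WINDOW** (modulus hypotheses, `0 < b₁`): `b ↦ ⟨F⟩_{μ b}` is
`ContDiffOn ℝ ∞` on `Icc 0 b₁`. -/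
theorem contDiffOn_infty_integral_Icc_SU (hN : 1 ≤ N) {R Kc b₁ : ℝ} (hK0 : 0 ≤ Kc)
    (hmod : OneLinkKRModulus N R Kc) (hR : b₁ / N * 6 ≤ R) (h925 : 4 * (Kc * (b₁ / N)) ≤ 9 / 25) (hb₁ : 0 < b₁)
    {μ : ℝ → Measure (LGConfig 4 (Matrix.specialUnitaryGroup (Fin N) ℂ))}
    (hμ : ∀ b ∈ Icc (0 : ℝ) b₁, μ b ∈ ymGibbsMeasures (d := 4) (fundamentalRep (Fin N)) b)
    {F : LGConfig 4 (Matrix.specialUnitaryGroup (Fin N) ℂ) → ℝ} {Λ : Finset (ZdEdge 4)} {K : ℝ≥0}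
    (hF : IsLipschitzCylinder (fundamentalRep (Fin N)) F Λ K)
    {x₀ : Site 4} {D : ℕ} (hD : ∀ e ∈ Λ, ‖e.1 - x₀‖ ≤ D) :
    ContDiffOn ℝ ∞ (fun t => ∫ U, F U ∂(μ t)) (Icc (0 : ℝ) b₁) := by
  classical
  have hU : UniqueDiffOn ℝ (Icc (0 : ℝ) b₁) := uniqueDiffOn_Icc hb₁
  set Rn : ℕ → ℝ → ℝ := fun n t => ∑' q : Fin n → ZdPlaquette 4, trunc (μ t) F 𝓦 q with hRn
  have hderiv : ∀ n, ∀ t ∈ Icc (0 : ℝ) b₁, HasDerivWithinAt (Rn n) ((N : ℝ) * Rn (n + 1) t) (Icc (0 : ℝ) b₁) t :=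
    fun n t ht => hasDerivWithinAt_truncSum_Icc_SU hN hK0 hmod hR h925 hμ hF hD n ht
  have hall : ∀ M : ℕ, ∀ n, ContDiffOn ℝ M (Rn n) (Icc (0 : ℝ) b₁) := by
    intro M
    induction M with
    | zero =>
      intro n
      exact contDiffOn_zero.2 fun t ht => (hderiv n t ht).continuousWithinAt
    | succ M ih =>
      intro n
      rw [show ((M + 1 : ℕ) : WithTop ℕ∞) = (M : WithTop ℕ∞) + 1 by push_cast; rfl,
        contDiffOn_succ_iff_derivWithin hU]
      refine ⟨fun t ht => (hderiv n t ht).differentiableWithinAt, fun h => absurd h (by simp), ?_⟩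
      exact (contDiffOn_const.mul (ih (n + 1))).congr fun t ht => (hderiv n t ht).derivWithin (hU t ht)
  have hR0 : ∀ t, Rn 0 t = ∫ U, F U ∂(μ t) := fun t => tsum_trunc_fin_zero_SU (μ t) F _
  exact (contDiffOn_infty.2 fun M => hall M 0).congr fun t _ => (hR0 t).symm

/-- ★★ **Every `SU(N)`, `N ≥ 2`, hypothesis-free: the state is `C^∞` on the CLOSED 't Hooft window `[0, N·9/308]`.** -/
theorem contDiffOn_infty_integral_Icc_SU_thooft (hN : 2 ≤ N)
    {μ : ℝ → Measure (LGConfig 4 (Matrix.specialUnitaryGroup (Fin N) ℂ))}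
    (hμ : ∀ b ∈ Icc (0 : ℝ) ((N : ℝ) * (9 / 308)), μ b ∈ ymGibbsMeasures (d := 4) (fundamentalRep (Fin N)) b)
    {F : LGConfig 4 (Matrix.specialUnitaryGroup (Fin N) ℂ) → ℝ} {Λ : Finset (ZdEdge 4)} {K : ℝ≥0}
    (hF : IsLipschitzCylinder (fundamentalRep (Fin N)) F Λ K)
    {x₀ : Site 4} {D : ℕ} (hD : ∀ e ∈ Λ, ‖e.1 - x₀‖ ≤ D) :
    ContDiffOn ℝ ∞ (fun t => ∫ U, F U ∂(μ t)) (Icc (0 : ℝ) ((N : ℝ) * (9 / 308))) := by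
  have hN0 : (0 : ℝ) < N := by exact_mod_cast (show 0 < N by omega)
  set b₁ : ℝ := (N : ℝ) * (9 / 308) with hb₁
  have hb₁N : b₁ / N = 9 / 308 := by rw [hb₁]; field_simp
  have hb₁0 : 0 < b₁ := by positivity
  obtain ⟨h1, hK0, h4⟩ := StarSUN.bakryEmery_coef_le (by omega) hb₁0.le hb₁N.le
  have hab : |b₁| / N = b₁ / N := by rw [abs_of_nonneg hb₁0.le]
  rw [hab] at h1 hK0 h4
  exact contDiffOn_infty_integral_Icc_SU (by omega) hK0 (oneLinkKRModulus_SU hN h1) le_rfl h4 hb₁0 hμ hF hD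

/-- ★★ **THE ITERATED DERIVATIVES WITHIN THE CLOSED WINDOW** (`SU(N)`, modulus hypotheses, `0 < b₁`): for every `n` and
every `b ∈ [0, b₁]`, `iteratedDerivWithin n (b ↦ ⟨F⟩_{μ b}) [0, b₁] b = Nⁿ · Σ_q u_{n+1}(F; W_{q 0}; …)_{μ b}`; at `b = 0` the
right-derivatives at the `β = 0` state. -/
theorem iteratedDerivWithin_integral_eq_SU (hN : 1 ≤ N) {R Kc b₁ : ℝ} (hK0 : 0 ≤ Kc)
    (hmod : OneLinkKRModulus N R Kc) (hR : b₁ / N * 6 ≤ R) (h925 : 4 * (Kc * (b₁ / N)) ≤ 9 / 25) (hb₁ : 0 < b₁)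
    {μ : ℝ → Measure (LGConfig 4 (Matrix.specialUnitaryGroup (Fin N) ℂ))}
    (hμ : ∀ b ∈ Icc (0 : ℝ) b₁, μ b ∈ ymGibbsMeasures (d := 4) (fundamentalRep (Fin N)) b)
    {F : LGConfig 4 (Matrix.specialUnitaryGroup (Fin N) ℂ) → ℝ} {Λ : Finset (ZdEdge 4)} {K : ℝ≥0}
    (hF : IsLipschitzCylinder (fundamentalRep (Fin N)) F Λ K)
    {x₀ : Site 4} {D : ℕ} (hD : ∀ e ∈ Λ, ‖e.1 - x₀‖ ≤ D) (n : ℕ) :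
    ∀ ⦃b : ℝ⦄, b ∈ Icc (0 : ℝ) b₁ →
      iteratedDerivWithin n (fun t => ∫ U, F U ∂(μ t)) (Icc (0 : ℝ) b₁) b =
        (N : ℝ) ^ n * ∑' q : Fin n → ZdPlaquette 4, trunc (μ b) F 𝓦 q := by
  have hU : UniqueDiffOn ℝ (Icc (0 : ℝ) b₁) := uniqueDiffOn_Icc hb₁
  induction n with
  | zero =>
    intro b _
    rw [iteratedDerivWithin_zero, tsum_trunc_fin_zero_SU, pow_zero, one_mul]
  | succ n ih =>
    intro b hb
    rw [iteratedDerivWithin_succ, derivWithin_congr (fun t ht => ih ht) (ih hb)]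
    rw [((hasDerivWithinAt_truncSum_Icc_SU hN hK0 hmod hR h925 hμ hF hD n hb).const_mul ((N : ℝ) ^ n)).derivWithin
      (hU b hb)]
    ring

end Summit.Ventures.YMGap.CouplingResponse

/-! ### §2 The `SU(N)` free energy density: open and closed window, asymptotic series -/

namespace Summit.Ventures.YMGap.PressureRegularity

open Summit.Ventures.YMGap.CouplingResponse (exists_dlrSelection_SU contDiffOn_infty_plaquette_SU_thooft
  contDiffOn_infty_integral_Icc_SU_thooft plaquetteObs_fundamentalRep_eq_mul_zdPlaquetteObs)

variable {N : ℕ}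

/-- Local shorthand: the planes `{(i, j) : i < j}` of `ℤ⁴`. -/
local notation3 (prettyPrint := false) "𝔓₄" => {q : Fin 4 × Fin 4 // q.1 < q.2}

/-- **Each plane plaquette expectation `⟨Re tr U_p⟩_{μ b} = N ⟨W_p⟩_{μ b}` is `C^∞` on the open AND on the closed 't Hooft
window** for every `SU(N)`, `N ≥ 2`, along any DLR selection. -/
theorem contDiffOn_infty_plaquette_tree_SU_thooft (hN : 2 ≤ N)
    {μ : ℝ → Measure (LGConfig 4 (Matrix.specialUnitaryGroup (Fin N) ℂ))}
    (hμ : ∀ b ∈ Icc (0 : ℝ) ((N : ℝ) * (9 / 308)), μ b ∈ ymGibbsMeasures (d := 4) (fundamentalRep (Fin N)) b)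
    (q : 𝔓₄) :
    ContDiffOn ℝ ∞ (fun t => ∫ U, plaquetteObs (fundamentalRep (Fin N)) 0 q.1.1 q.1.2 U ∂(μ t))
        (Ioo (0 : ℝ) ((N : ℝ) * (9 / 308))) ∧
      ContDiffOn ℝ ∞ (fun t => ∫ U, plaquetteObs (fundamentalRep (Fin N)) 0 q.1.1 q.1.2 U ∂(μ t))
        (Icc (0 : ℝ) ((N : ℝ) * (9 / 308))) := by
  have hscale : (fun t => ∫ U, plaquetteObs (fundamentalRep (Fin N)) 0 q.1.1 q.1.2 U ∂(μ t)) =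
      fun t => (N : ℝ) * ∫ U, zdPlaquetteObs (fundamentalRep (Fin N))
        (0 : Literature.Probability.LatticeModels.Site 4) q.1.1 q.1.2 U ∂(μ t) := by
    funext t
    rw [← integral_const_mul]
    refine integral_congr_ae (ae_of_all _ fun U => ?_)
    rw [plaquetteObs_fundamentalRep_eq_mul_zdPlaquetteObs]
  rw [hscale]
  exact ⟨contDiffOn_const.mul (contDiffOn_infty_plaquette_SU_thooft hN hμ
      ((0 : Literature.Probability.LatticeModels.Site 4), q)),
    contDiffOn_const.mul (contDiffOn_infty_integral_Icc_SU_thooft hN hμ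
      (isLipschitzCylinder_zdPlaquetteObs (N := N) (0 : Literature.Probability.LatticeModels.Site 4) q.2)
      (x₀ := 0) (D := 1) (fun e he => by simpa using norm_fst_sub_le_of_mem_plaquetteEdges he))⟩

/-- ★★★ **THE `SU(N)` FREE ENERGY DENSITY IS `C^∞` ON THE OPEN WINDOW `(0, N·9/308)`**, every `N ≥ 2`, hypothesis-free
(`f' = −Σ_{i<j} (N − ⟨Re tr U_{p_ij}⟩_{μ b})`, g9's `hasDerivAt_freeEnergyDensity_SU_thooft`). -/
theorem contDiffOn_infty_freeEnergyDensity_SU_thooft (hN : 2 ≤ N) :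
    ContDiffOn ℝ ∞ (freeEnergyDensity 4 (fundamentalRep (Fin N))) (Ioo (0 : ℝ) ((N : ℝ) * (9 / 308))) := by
  obtain ⟨μ, hμ⟩ := exists_dlrSelection_SU (N := N)
  have hμsel : ∀ t ∈ Icc (0 : ℝ) ((N : ℝ) * (9 / 308)), μ t ∈ ymGibbsMeasures (d := 4) (fundamentalRep (Fin N)) t :=
    fun t _ => hμ t
  rw [contDiffOn_infty_iff_deriv_of_isOpen isOpen_Ioo]
  refine ⟨fun t ht => (hasDerivAt_freeEnergyDensity_SU_thooft hN hμsel ht).differentiableAt.differentiableWithinAt, ?_⟩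
  have hrhs : ContDiffOn ℝ ∞
      (fun t => -∑ q : 𝔓₄, ((N : ℝ) - ∫ U, plaquetteObs (fundamentalRep (Fin N)) 0 q.1.1 q.1.2 U ∂(μ t)))
      (Ioo (0 : ℝ) ((N : ℝ) * (9 / 308))) :=
    (ContDiffOn.sum fun q _ => contDiffOn_const.sub (contDiffOn_infty_plaquette_tree_SU_thooft hN hμsel q).1).neg
  refine hrhs.congr fun t ht => ?_
  exact (hasDerivAt_freeEnergyDensity_SU_thooft hN hμsel ht).deriv

/-- ★★★ **THE `SU(N)` FREE ENERGY DENSITY IS `C^∞` ON THE CLOSED WINDOW `[0, N·9/308]`**, every `N ≥ 2`, hypothesis-free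
(one-sided at the ends; g9's `hasDerivWithinAt_freeEnergyDensity_SU_thooft`). -/
theorem contDiffOn_infty_freeEnergyDensity_Icc_SU_thooft (hN : 2 ≤ N) :
    ContDiffOn ℝ ∞ (freeEnergyDensity 4 (fundamentalRep (Fin N))) (Icc (0 : ℝ) ((N : ℝ) * (9 / 308))) := by
  obtain ⟨μ, hμ⟩ := exists_dlrSelection_SU (N := N)
  have hμsel : ∀ t ∈ Icc (0 : ℝ) ((N : ℝ) * (9 / 308)), μ t ∈ ymGibbsMeasures (d := 4) (fundamentalRep (Fin N)) t :=
    fun t _ => hμ t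
  have hN0 : (0 : ℝ) < N := by exact_mod_cast (show 0 < N by omega)
  have hU : UniqueDiffOn ℝ (Icc (0 : ℝ) ((N : ℝ) * (9 / 308))) := uniqueDiffOn_Icc (by positivity)
  rw [contDiffOn_infty_iff_derivWithin hU]
  refine ⟨fun t ht => (hasDerivWithinAt_freeEnergyDensity_SU_thooft hN hμsel ht).differentiableWithinAt, ?_⟩
  have hrhs : ContDiffOn ℝ ∞
      (fun t => -∑ q : 𝔓₄, ((N : ℝ) - ∫ U, plaquetteObs (fundamentalRep (Fin N)) 0 q.1.1 q.1.2 U ∂(μ t)))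
      (Icc (0 : ℝ) ((N : ℝ) * (9 / 308))) :=
    (ContDiffOn.sum fun q _ => contDiffOn_const.sub (contDiffOn_infty_plaquette_tree_SU_thooft hN hμsel q).2).neg
  refine hrhs.congr fun t ht => ?_
  exact (hasDerivWithinAt_freeEnergyDensity_SU_thooft hN hμsel ht).derivWithin (hU t ht)

/-- ★★★ **THE `SU(N)` STRONG-COUPLING EXPANSION IS AN ASYMPTOTIC SERIES TO ALL ORDERS**, every `N ≥ 2`, hypothesis-free:
`∀ n ∃ C ∀ b ∈ [0, N·9/308], |f b − taylorWithinEval f n [0, N·9/308] 0 b| ≤ C b^{n+1}`. -/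
theorem freeEnergyDensity_taylor_all_orders_SU_thooft (hN : 2 ≤ N) (n : ℕ) :
    ∃ C : ℝ, ∀ b ∈ Icc (0 : ℝ) ((N : ℝ) * (9 / 308)),
      |freeEnergyDensity 4 (fundamentalRep (Fin N)) b -
          taylorWithinEval (freeEnergyDensity 4 (fundamentalRep (Fin N))) n (Icc (0 : ℝ) ((N : ℝ) * (9 / 308))) 0 b| ≤
        C * b ^ (n + 1) := by
  have hN0 : (0 : ℝ) < N := by exact_mod_cast (show 0 < N by omega)
  have hpos : (0 : ℝ) ≤ (N : ℝ) * (9 / 308) := by positivity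
  have hf := contDiffOn_infty_freeEnergyDensity_Icc_SU_thooft hN
  have hfn : ContDiffOn ℝ (n + 1) (freeEnergyDensity 4 (fundamentalRep (Fin N))) (Icc (0 : ℝ) ((N : ℝ) * (9 / 308))) :=
    hf.of_le (by exact_mod_cast le_top)
  have hcont : ContinuousOn (iteratedDerivWithin (n + 1) (freeEnergyDensity 4 (fundamentalRep (Fin N)))
      (Icc (0 : ℝ) ((N : ℝ) * (9 / 308)))) (Icc (0 : ℝ) ((N : ℝ) * (9 / 308))) :=
    hf.continuousOn_iteratedDerivWithin (by exact_mod_cast le_top) (uniqueDiffOn_Icc (by positivity))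
  obtain ⟨C, hC⟩ := (isCompact_Icc.image_of_continuousOn hcont).isBounded.exists_norm_le
  refine ⟨C / n.factorial, fun b hb => ?_⟩
  have h := taylor_mean_remainder_bound (f := freeEnergyDensity 4 (fundamentalRep (Fin N))) (a := 0)
    (b := (N : ℝ) * (9 / 308)) (n := n) hpos hfn hb (fun y hy => hC _ (Set.mem_image_of_mem _ hy))
  rw [sub_zero, Real.norm_eq_abs] at h
  calc _ ≤ C * b ^ (n + 1) / n.factorial := h
    _ = C / n.factorial * b ^ (n + 1) := by ring

end Summit.Ventures.YMGap.PressureRegularity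

end
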